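import Literature.NumberTheory.DiophantineGeometry.FunctionFieldDivisors
import HarnessLib

/-!
# Places of `F/K`: nonzero constants have order zero — discharged fact

Proof of the named fact `Literature.NumberTheory.DiophantineGeometry.AlgFunctionField.PlaceOver.ord_algebraMap` stated in
`Literature.NumberTheory.DiophantineGeometry.FunctionFieldDivisors` (kept in a sibling file so
that the statement file stays a definitions/named-facts file):

* `Literature.AlgFunctionField.PlaceOver.ord_algebraMap_holds : ord_algebraMap`, i.e. for every place
  `v` of `F/K` and every constant `0 ≠ c ∈ K`, `ord_v c = 0`.

## Source and proof architecture

H. Stichtenoth, *Algebraic Function Fields and Codes*, 2nd ed., GTM 254 (2009), §1.1: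

* Prop. 1.1.5 (c): for a valuation ring `O` of `F/K` with maximal ideal `P`, the constants lie
  in `O` and `K̃ ∩ P = {0}`; hence a nonzero constant is a unit of `O`.
* Def. 1.1.9 (5): a discrete valuation of `F/K` satisfies `v(a) = 0` for all `0 ≠ a ∈ K`;
  Def. 1.1.12 / Thm. 1.1.13 (a): `v_P` (defined by `z = tⁿ u`, `u ∈ O_P^×`, `v_P(z) := n`) is a
  discrete valuation of `F/K`, and `O_P^× = {z ∈ F | v_P(z) = 0}`.

(The docstring of the fact quotes the first-edition numbering "I.1.5 / I.1.11 (5)"; in the 2009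
edition the same items are Prop. 1.1.5 (c), Def. 1.1.9 (5) and Def. 1.1.12/Thm. 1.1.13 (a). The
statement itself is faithful.)

In Lean: `K ⊆ O_v` is the field `PlaceOver.algebraMap_mem` (packaged as the algebra
`PlaceOver.algebraK : Algebra K O_v`), so `c ≠ 0` maps to a unit of `O_v` (`IsUnit.map`); for
`x ∈ O_v` the order is `ord_v x = (addVal x).toNat` by definition of `PlaceOver.ord`, and Mathlib's
`IsDiscreteValuationRing.addVal_eq_zero_iff` (`addVal x = 0 ↔ IsUnit x`) is exactly
Thm. 1.1.13 (a)'s description of `O_P^×`.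

## References

* H. Stichtenoth, *Algebraic Function Fields and Codes*, GTM 254, Springer 2009, §1.1:
  Prop. 1.1.5 (c), Def. 1.1.9 (5), Def. 1.1.12, Thm. 1.1.13 (a).
-/

noncomputable section

namespace Literature.NumberTheory.DiophantineGeometry.AlgFunctionField.PlaceOver

universe u v

variable {K : Type u} {F : Type v} [Field K] [Field F] [Algebra K F]

/-- Unfolding of `PlaceOver.ord` on the valuation ring: for `x ∈ O_v`,
`ord_v x = addVal x` (as a natural number cast to `ℤ`; Stichtenoth Def. 1.1.12: `x = tⁿ u`,
`v_P(x) = n ≥ 0`). [folklore] -/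
theorem ord_of_mem (v : PlaceOver K F) {x : F} (hx : x ∈ v.toValuationSubring) :
    v.ord x = ((IsDiscreteValuationRing.addVal v.toValuationSubring ⟨x, hx⟩).toNat : ℤ) := by
  unfold ord
  rw [dif_pos hx]

/-- Units of the valuation ring have order zero: `O_P^× ⊆ {z | v_P(z) = 0}` (Stichtenoth
Thm. 1.1.13 (a); in Mathlib `IsDiscreteValuationRing.addVal_eq_zero_iff`).
[cite: Stichtenoth2009, Thm. 1.1.13(a)] -/
theorem ord_eq_zero_of_isUnit (v : PlaceOver K F) {x : F} (hx : x ∈ v.toValuationSubring)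
    (hu : IsUnit (⟨x, hx⟩ : v.toValuationSubring)) : v.ord x = 0 := by
  rw [ord_of_mem v hx, IsDiscreteValuationRing.addVal_eq_zero_iff.mpr hu]
  rfl

/-- A nonzero constant `c ∈ K` is a unit of every valuation ring `O_v ⊇ K` of `F/K`
(Stichtenoth Prop. 1.1.5 (c): `K ⊆ K̃ ⊆ O` and `K̃ ∩ P = {0}`); here simply because the ring map
`K → O_v` (`PlaceOver.algebraK`) preserves units. [cite: Stichtenoth2009, Prop. 1.1.5(c)] -/
theorem isUnit_algebraMap_toValuationSubring (v : PlaceOver K F) {c : K} (hc : c ≠ 0) :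
    IsUnit (algebraMap K v.toValuationSubring c) :=
  (Ne.isUnit hc).map (algebraMap K v.toValuationSubring)

/-- **Discharge of `PlaceOver.ord_algebraMap`**: nonzero constants have order `0` at every place,
`v_P(a) = 0` for all `0 ≠ a ∈ K` (Stichtenoth Def. 1.1.9 (5) with Thm. 1.1.13 (a), via
Prop. 1.1.5 (c); first-edition numbering I.1.5 / I.1.11 (5) as quoted in the fact's docstring).
Proof: `c ≠ 0` is a unit of `O_v` (`isUnit_algebraMap_toValuationSubring`), and units have order
`0` (`ord_eq_zero_of_isUnit`).
[cite: Stichtenoth2009, §1.1: Prop. 1.1.5(c), Def. 1.1.9(5), Thm. 1.1.13(a)] -/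
theorem ord_algebraMap_holds : ord_algebraMap (K := K) (F := F) := by
  intro v c hc
  have h := ord_eq_zero_of_isUnit v (v.algebraMap_mem c)
    (isUnit_algebraMap_toValuationSubring v hc)
  simpa using h

end Literature.NumberTheory.DiophantineGeometry.AlgFunctionField.PlaceOver
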